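import Summits.CriticalPhenomena.PercolationContinuityZ3.Theorems.PercNearOneGluingNoHeavyLowerTailMonotonePolarizedStrongHarrisStep
import HarnessLib

/-!
# `NoHeavyLowerTail` (stmt-CriticalPhenomena-4575) — the MONOTONE POLARIZED strong Harris inequality
# (E3GRP-by-switching line, strategy 3, cell `prim-e3grp`, seat `prim-e3grp-switch-3` gen 2)

Support file (`--supports stmt-CriticalPhenomena-4575`).  NEW RESULT of this programme (not a published
statement): a two-measure ("polarized") strengthening of Gladkov's strong Harris–Kleitman inequality
(`Literature.Probability.LatticeModels.prodBernoulli_strongHarris`, Gladkov 2024 Thm. 2.1, which is the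
diagonal case `p = p'`, `S = S'` below).

## Statement

Let `μ = prodBernoulli p` and `ν = prodBernoulli p'` be two product measures on `Set ι` with
`p' ≤ p` coordinatewise, and let `(A, (C i)_{i∈s}, B)` and `(A', (C' i)_{i∈s}, B')` be two Gladkov
systems of cylinder events (the `C i` pairwise disjoint and disjoint from the up-set `A`, every
`A ∪ C i` closed upwards, `B` the complement of `A ∪ ⋃ C i`; likewise primed) satisfying the
CROSS-CONDITION: for `i ≠ j` there are no `ω' ≤ ω` with `ω ∈ C i` and `ω' ∈ C' j` (automatic for
`S' = S`, `MonotonePolarizedStrongHarris.cross_self`).  Then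
`Σ_{i ≠ j} μ(C i) ν(C' j) ≤ μ(A) ν(B') + ν(A') μ(B)`
(`MonotonePolarizedStrongHarris.core`, `prodBernoulli_polarized_strongHarris`), written without double
sums as `(Σ_i μ(C i))(Σ_j ν(C' j)) − Σ_i μ(C i) ν(C' i) ≤ μ(A) ν(B') + ν(A') μ(B)`.
For `p = p'`, `S = S'` this is `2 e₂(μ(C_i)) ≤ 2 μ(A) μ(B)`, Gladkov's theorem.  The hypothesis
`p' ≤ p` cannot be dropped (the three-point percolation instance fails for incomparable parameters).

Percolation reading (three-petal sunflower, `prodBernoulli_polarized_strongHarris_sunflower_three`):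
for edge-weights `w' ≤ w` and three vertices, with `q = P(a|b|c)`, `t = P(abc)`, `u_x = P(x cut from
the other two, which are joined)` under `w` and primed under `w'`:
`q t' + q' t ≥ Σ_{x ≠ z} u_x u'_z` — the Aas–Gladkov inequality `q t ≥ e₂(u)` POLARIZED along a monotone
pair of parameters.  Motivation (memo run/shared/lean/prim/prim-e3grp/prim-e3grp-switch-3/
FINDINGS-switch3-g2.md): along a chain `w ≥ w' ≥ w''` the cubic rows `T_inc`, `3PT-LB` and the last
open E3GRP class `γ` are numerically nonnegative in fully polarized form, which would make every
one-edge Bernstein step of an edge induction automatic; this file proves the quadratic prototype.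

## Proof

Gladkov's induction on the set `F` of coordinates, run for PAIRS of systems.  Exposing a
coordinate `e` with `μ`-weight `p_e` and `ν`-weight `p'_e ≤ p_e`, the defect is bi-affine in
`(p_e, p'_e)` and equals `(1 − p_e) g₀₀ + p'_e g₁₁ + (p_e − p'_e) g₁₀ + (1 − p_e) p'_e G` where
`g_{αβ}` is the defect of the pair (upper/lower sections) — `g₀₀, g₁₁, g₁₀ ≥ 0` by induction (the
cross-condition is inherited by all three section pairs) — and
`G = g₁₀ + g₀₁ − g₀₀ − g₁₁ ≥ Σ_i (t_i v'_i + v_i t'_i) + Σ_{i ≠ j} (v_i v'_j + t_i t'_j) ≥ 0` in terms of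
Gladkov's transition masses of the two systems (`step_arith`).  The base case `F = ∅` is where the
cross-condition is used.
-/

noncomputable section

namespace Summit.CriticalPhenomena.PercolationContinuityZ3.Theorems

open MeasureTheory Measure
open Literature.Probability.LatticeModels Literature.Probability.LatticeModels.StrongHarris
open Literature.Probability.Percolation

variable {ι : Type*}

namespace MonotonePolarizedStrongHarris

/-- **The core statement for pairs**, by induction on the finite set `F` of coordinates: for two
Gladkov systems of cylinder events over `F` satisfying the cross-condition, and two product measures
with `p' ≤ p`, `(Σ μ(C i))(Σ ν(C' j)) − Σ μ(C i) ν(C' i) ≤ μ(A) ν(B') + ν(A') μ(B)`. [this work] -/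
theorem core [DecidableEq ι] (p p' : ι → unitInterval) (hpp : ∀ e, (p' e : ℝ) ≤ p e) {κ : Type*}
    (s : Finset κ) (F : Finset ι) :
    ∀ (A B : Set (Set ι)) (C : κ → Set (Set ι)) (A' B' : Set (Set ι)) (C' : κ → Set (Set ι)),
      (∀ i ∈ s, ∀ j ∈ s, i ≠ j → Disjoint (C i) (C j)) → (∀ i ∈ s, Disjoint A (C i)) →
      (∀ i ∈ s, IsUpperSet (A ∪ C i)) → IsUpperSet A →
      (∀ ω, ω ∈ B ↔ ω ∉ A ∧ ∀ i ∈ s, ω ∉ C i) →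
      DeterminedBy A (↑F : Set ι) → (∀ i ∈ s, DeterminedBy (C i) (↑F : Set ι)) →
      (∀ i ∈ s, ∀ j ∈ s, i ≠ j → Disjoint (C' i) (C' j)) → (∀ i ∈ s, Disjoint A' (C' i)) →
      (∀ i ∈ s, IsUpperSet (A' ∪ C' i)) → IsUpperSet A' →
      (∀ ω, ω ∈ B' ↔ ω ∉ A' ∧ ∀ i ∈ s, ω ∉ C' i) →
      DeterminedBy A' (↑F : Set ι) → (∀ i ∈ s, DeterminedBy (C' i) (↑F : Set ι)) →
      (∀ i ∈ s, ∀ j ∈ s, i ≠ j → ∀ ω ω' : Set ι, ω' ≤ ω → ω ∈ C i → ω' ∉ C' j) →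
      (∑ i ∈ s, (prodBernoulli p).real (C i)) * (∑ i ∈ s, (prodBernoulli p').real (C' i)) -
          ∑ i ∈ s, (prodBernoulli p).real (C i) * (prodBernoulli p').real (C' i) ≤
        (prodBernoulli p).real A * (prodBernoulli p').real B' +
          (prodBernoulli p').real A' * (prodBernoulli p).real B := by
  set μ := prodBernoulli p with hμ
  set ν := prodBernoulli p' with hν
  induction F using Finset.induction_on with
  | empty =>
    intro A B C A' B' C' hdisj hdisjA hup hupA hB hA hC hdisj' hdisjA' hup' hupA' hB' hA' hC' hX
    classical
    -- every event is `∅` or `univ`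
    have triv : ∀ X : Set (Set ι), DeterminedBy X (↑(∅ : Finset ι) : Set ι) →
        X = ∅ ∨ X = Set.univ := by
      intro X hXd
      rw [determinedBy_iff] at hXd
      by_cases hne : X.Nonempty
      · obtain ⟨ω₀, hω₀⟩ := hne
        exact Or.inr (Set.eq_univ_of_forall fun ω => (hXd ω ω₀ (by simp)).2 hω₀)
      · exact Or.inl (Set.not_nonempty_iff_eq_empty.1 hne)
    -- for `i ≠ j` the product `μ(C i) ν(C' j)` vanishes by the cross-condition
    have hzero : ∀ i ∈ s, ∀ j ∈ s, i ≠ j → μ.real (C i) * ν.real (C' j) = 0 := by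
      intro i hi j hj hij
      rcases triv (C i) (hC i hi) with h | h
      · rw [h, measureReal_empty, zero_mul]
      rcases triv (C' j) (hC' j hj) with h' | h'
      · rw [h', measureReal_empty, mul_zero]
      exfalso
      have h1 : (∅ : Set ι) ∈ C i := by rw [h]; trivial
      have h2 : (∅ : Set ι) ∈ C' j := by rw [h']; trivial
      exact hX i hi j hj hij ∅ ∅ le_rfl h1 h2
    have hsplit : (∑ i ∈ s, μ.real (C i)) * (∑ i ∈ s, ν.real (C' i)) =
        ∑ i ∈ s, μ.real (C i) * ν.real (C' i) := by
      rw [Finset.sum_mul_sum]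
      refine Finset.sum_congr rfl fun i hi => ?_
      rw [← Finset.add_sum_erase s _ hi]
      have : ∑ j ∈ s.erase i, μ.real (C i) * ν.real (C' j) = 0 :=
        Finset.sum_eq_zero fun j hj => hzero i hi j (Finset.mem_of_mem_erase hj)
          (Finset.ne_of_mem_erase hj).symm
      rw [this, add_zero]
    rw [hsplit, sub_self]
    positivity
  | insert e F' he ih =>
    intro A B C A' B' C' hdisj hdisjA hup hupA hB hA hC hdisj' hdisjA' hup' hupA' hB' hA' hC' hX
    -- sections of both systems are again systems of cylinder events over `F'`
    have hle : ∀ ω : Set ι, ω \ {e} ≤ insert e ω := fun ω =>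
      (Set.sdiff_subset).trans (Set.subset_insert e ω)
    have hBdet : DeterminedBy B (↑(insert e F') : Set ι) := determinedBy_bottom hB hA hC
    have hBdet' : DeterminedBy B' (↑(insert e F') : Set ι) := determinedBy_bottom hB' hA' hC'
    -- hypotheses for the section systems
    have sys₁ : (∀ i ∈ s, ∀ j ∈ s, i ≠ j → Disjoint (insert e ⁻¹' C i) (insert e ⁻¹' C j)) ∧
        (∀ i ∈ s, Disjoint (insert e ⁻¹' A) (insert e ⁻¹' C i)) ∧
        (∀ i ∈ s, IsUpperSet (insert e ⁻¹' A ∪ insert e ⁻¹' C i)) ∧ IsUpperSet (insert e ⁻¹' A) ∧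
        (∀ ω, ω ∈ insert e ⁻¹' B ↔ ω ∉ insert e ⁻¹' A ∧ ∀ i ∈ s, ω ∉ insert e ⁻¹' C i) ∧
        DeterminedBy (insert e ⁻¹' A) (↑F' : Set ι) ∧
        (∀ i ∈ s, DeterminedBy (insert e ⁻¹' C i) (↑F' : Set ι)) :=
      ⟨fun i hi j hj hij => (hdisj i hi j hj hij).preimage _, fun i hi => (hdisjA i hi).preimage _,
        fun i hi => isUpperSet_preimage_insert (hup i hi), isUpperSet_preimage_insert hupA,
        fun ω => by simpa using hB (insert e ω), determinedBy_preimage_insert hA,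
        fun i hi => determinedBy_preimage_insert (hC i hi)⟩
    have sys₀ : (∀ i ∈ s, ∀ j ∈ s, i ≠ j → Disjoint ((· \ {e}) ⁻¹' C i) ((· \ {e}) ⁻¹' C j)) ∧
        (∀ i ∈ s, Disjoint ((· \ {e}) ⁻¹' A) ((· \ {e}) ⁻¹' C i)) ∧
        (∀ i ∈ s, IsUpperSet ((· \ {e}) ⁻¹' A ∪ (· \ {e}) ⁻¹' C i)) ∧ IsUpperSet ((· \ {e}) ⁻¹' A) ∧
        (∀ ω, ω ∈ (· \ {e}) ⁻¹' B ↔ ω ∉ (· \ {e}) ⁻¹' A ∧ ∀ i ∈ s, ω ∉ (· \ {e}) ⁻¹' C i) ∧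
        DeterminedBy ((· \ {e}) ⁻¹' A) (↑F' : Set ι) ∧
        (∀ i ∈ s, DeterminedBy ((· \ {e}) ⁻¹' C i) (↑F' : Set ι)) :=
      ⟨fun i hi j hj hij => (hdisj i hi j hj hij).preimage _, fun i hi => (hdisjA i hi).preimage _,
        fun i hi => isUpperSet_preimage_sdiff (hup i hi), isUpperSet_preimage_sdiff hupA,
        fun ω => by simpa using hB (ω \ {e}), determinedBy_preimage_sdiff hA,
        fun i hi => determinedBy_preimage_sdiff (hC i hi)⟩
    have sys₁' : (∀ i ∈ s, ∀ j ∈ s, i ≠ j → Disjoint (insert e ⁻¹' C' i) (insert e ⁻¹' C' j)) ∧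
        (∀ i ∈ s, Disjoint (insert e ⁻¹' A') (insert e ⁻¹' C' i)) ∧
        (∀ i ∈ s, IsUpperSet (insert e ⁻¹' A' ∪ insert e ⁻¹' C' i)) ∧ IsUpperSet (insert e ⁻¹' A') ∧
        (∀ ω, ω ∈ insert e ⁻¹' B' ↔ ω ∉ insert e ⁻¹' A' ∧ ∀ i ∈ s, ω ∉ insert e ⁻¹' C' i) ∧
        DeterminedBy (insert e ⁻¹' A') (↑F' : Set ι) ∧
        (∀ i ∈ s, DeterminedBy (insert e ⁻¹' C' i) (↑F' : Set ι)) :=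
      ⟨fun i hi j hj hij => (hdisj' i hi j hj hij).preimage _, fun i hi => (hdisjA' i hi).preimage _,
        fun i hi => isUpperSet_preimage_insert (hup' i hi), isUpperSet_preimage_insert hupA',
        fun ω => by simpa using hB' (insert e ω), determinedBy_preimage_insert hA',
        fun i hi => determinedBy_preimage_insert (hC' i hi)⟩
    have sys₀' : (∀ i ∈ s, ∀ j ∈ s, i ≠ j → Disjoint ((· \ {e}) ⁻¹' C' i) ((· \ {e}) ⁻¹' C' j)) ∧
        (∀ i ∈ s, Disjoint ((· \ {e}) ⁻¹' A') ((· \ {e}) ⁻¹' C' i)) ∧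
        (∀ i ∈ s, IsUpperSet ((· \ {e}) ⁻¹' A' ∪ (· \ {e}) ⁻¹' C' i)) ∧ IsUpperSet ((· \ {e}) ⁻¹' A') ∧
        (∀ ω, ω ∈ (· \ {e}) ⁻¹' B' ↔ ω ∉ (· \ {e}) ⁻¹' A' ∧ ∀ i ∈ s, ω ∉ (· \ {e}) ⁻¹' C' i) ∧
        DeterminedBy ((· \ {e}) ⁻¹' A') (↑F' : Set ι) ∧
        (∀ i ∈ s, DeterminedBy ((· \ {e}) ⁻¹' C' i) (↑F' : Set ι)) :=
      ⟨fun i hi j hj hij => (hdisj' i hi j hj hij).preimage _, fun i hi => (hdisjA' i hi).preimage _,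
        fun i hi => isUpperSet_preimage_sdiff (hup' i hi), isUpperSet_preimage_sdiff hupA',
        fun ω => by simpa using hB' (ω \ {e}), determinedBy_preimage_sdiff hA',
        fun i hi => determinedBy_preimage_sdiff (hC' i hi)⟩
    obtain ⟨hX₁₁, hX₀₀, hX₁₀⟩ := cross_sections e hX
    -- the three induction hypotheses
    have ih₁₁ := ih _ _ _ _ _ _ sys₁.1 sys₁.2.1 sys₁.2.2.1 sys₁.2.2.2.1 sys₁.2.2.2.2.1 sys₁.2.2.2.2.2.1
      sys₁.2.2.2.2.2.2 sys₁'.1 sys₁'.2.1 sys₁'.2.2.1 sys₁'.2.2.2.1 sys₁'.2.2.2.2.1 sys₁'.2.2.2.2.2.1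
      sys₁'.2.2.2.2.2.2 hX₁₁
    have ih₀₀ := ih _ _ _ _ _ _ sys₀.1 sys₀.2.1 sys₀.2.2.1 sys₀.2.2.2.1 sys₀.2.2.2.2.1 sys₀.2.2.2.2.2.1
      sys₀.2.2.2.2.2.2 sys₀'.1 sys₀'.2.1 sys₀'.2.2.1 sys₀'.2.2.2.1 sys₀'.2.2.2.2.1 sys₀'.2.2.2.2.2.1
      sys₀'.2.2.2.2.2.2 hX₀₀
    have ih₁₀ := ih _ _ _ _ _ _ sys₁.1 sys₁.2.1 sys₁.2.2.1 sys₁.2.2.2.1 sys₁.2.2.2.2.1 sys₁.2.2.2.2.2.1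
      sys₁.2.2.2.2.2.2 sys₀'.1 sys₀'.2.1 sys₀'.2.2.1 sys₀'.2.2.2.1 sys₀'.2.2.2.2.1 sys₀'.2.2.2.2.2.1
      sys₀'.2.2.2.2.2.2 hX₁₀
    -- transition data of the two systems
    obtain ⟨u, v, t, hv, ht, hc₁, hc₀, ha, hb⟩ :=
      sectionData p s e F' hdisj hdisjA hup hupA hB hA hC
    obtain ⟨u', v', t', hv', ht', hc₁', hc₀', ha', hb'⟩ :=
      sectionData p' s e F' hdisj' hdisjA' hup' hupA' hB' hA' hC'
    -- one-coordinate decompositions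
    have dA := real_eq_preimage_insert_add_preimage_sdiff p e hA
    have dB := real_eq_preimage_insert_add_preimage_sdiff p e hBdet
    have dA' := real_eq_preimage_insert_add_preimage_sdiff p' e hA'
    have dB' := real_eq_preimage_insert_add_preimage_sdiff p' e hBdet'
    have dC : ∀ i ∈ s, μ.real (C i) = p e * (u i + v i) + (1 - p e) * (u i + t i) := by
      intro i hi
      rw [hμ, real_eq_preimage_insert_add_preimage_sdiff p e (hC i hi), hc₁ i hi, hc₀ i hi]
    have dC' : ∀ i ∈ s, ν.real (C' i) = p' e * (u' i + v' i) + (1 - p' e) * (u' i + t' i) := by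
      intro i hi
      rw [hν, real_eq_preimage_insert_add_preimage_sdiff p' e (hC' i hi), hc₁' i hi, hc₀' i hi]
    have eS : ∑ i ∈ s, μ.real (C i) = ∑ i ∈ s, (p e * (u i + v i) + (1 - p e) * (u i + t i)) :=
      Finset.sum_congr rfl dC
    have eS' : ∑ i ∈ s, ν.real (C' i) = ∑ i ∈ s, (p' e * (u' i + v' i) + (1 - p' e) * (u' i + t' i)) :=
      Finset.sum_congr rfl dC'
    have eSS : ∑ i ∈ s, μ.real (C i) * ν.real (C' i) =
        ∑ i ∈ s, (p e * (u i + v i) + (1 - p e) * (u i + t i)) *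
          (p' e * (u' i + v' i) + (1 - p' e) * (u' i + t' i)) :=
      Finset.sum_congr rfl fun i hi => by rw [dC i hi, dC' i hi]
    -- the induction hypotheses in terms of the transition data
    have g₁₁ : (∑ i ∈ s, (u i + v i)) * (∑ i ∈ s, (u' i + v' i)) - ∑ i ∈ s, (u i + v i) * (u' i + v' i) ≤
        μ.real (insert e ⁻¹' A) * ν.real (insert e ⁻¹' B') +
          ν.real (insert e ⁻¹' A') * μ.real (insert e ⁻¹' B) := by
      have e1 : ∑ i ∈ s, μ.real (insert e ⁻¹' C i) = ∑ i ∈ s, (u i + v i) := Finset.sum_congr rfl hc₁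
      have e2 : ∑ i ∈ s, ν.real (insert e ⁻¹' C' i) = ∑ i ∈ s, (u' i + v' i) :=
        Finset.sum_congr rfl hc₁'
      have e3 : ∑ i ∈ s, μ.real (insert e ⁻¹' C i) * ν.real (insert e ⁻¹' C' i) =
          ∑ i ∈ s, (u i + v i) * (u' i + v' i) :=
        Finset.sum_congr rfl fun i hi => by rw [hc₁ i hi, hc₁' i hi]
      rw [← e1, ← e2, ← e3]; exact ih₁₁
    have g₀₀ : (∑ i ∈ s, (u i + t i)) * (∑ i ∈ s, (u' i + t' i)) - ∑ i ∈ s, (u i + t i) * (u' i + t' i) ≤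
        μ.real ((· \ {e}) ⁻¹' A) * ν.real ((· \ {e}) ⁻¹' B') +
          ν.real ((· \ {e}) ⁻¹' A') * μ.real ((· \ {e}) ⁻¹' B) := by
      have e1 : ∑ i ∈ s, μ.real ((· \ {e}) ⁻¹' C i) = ∑ i ∈ s, (u i + t i) := Finset.sum_congr rfl hc₀
      have e2 : ∑ i ∈ s, ν.real ((· \ {e}) ⁻¹' C' i) = ∑ i ∈ s, (u' i + t' i) :=
        Finset.sum_congr rfl hc₀'
      have e3 : ∑ i ∈ s, μ.real ((· \ {e}) ⁻¹' C i) * ν.real ((· \ {e}) ⁻¹' C' i) =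
          ∑ i ∈ s, (u i + t i) * (u' i + t' i) :=
        Finset.sum_congr rfl fun i hi => by rw [hc₀ i hi, hc₀' i hi]
      rw [← e1, ← e2, ← e3]; exact ih₀₀
    have g₁₀ : (∑ i ∈ s, (u i + v i)) * (∑ i ∈ s, (u' i + t' i)) - ∑ i ∈ s, (u i + v i) * (u' i + t' i) ≤
        μ.real (insert e ⁻¹' A) * ν.real ((· \ {e}) ⁻¹' B') +
          ν.real ((· \ {e}) ⁻¹' A') * μ.real (insert e ⁻¹' B) := by
      have e1 : ∑ i ∈ s, μ.real (insert e ⁻¹' C i) = ∑ i ∈ s, (u i + v i) := Finset.sum_congr rfl hc₁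
      have e2 : ∑ i ∈ s, ν.real ((· \ {e}) ⁻¹' C' i) = ∑ i ∈ s, (u' i + t' i) :=
        Finset.sum_congr rfl hc₀'
      have e3 : ∑ i ∈ s, μ.real (insert e ⁻¹' C i) * ν.real ((· \ {e}) ⁻¹' C' i) =
          ∑ i ∈ s, (u i + v i) * (u' i + t' i) :=
        Finset.sum_congr rfl fun i hi => by rw [hc₁ i hi, hc₀' i hi]
      rw [← e1, ← e2, ← e3]; exact ih₁₀
    rw [eSS, eS, eS', hμ, hν, dA, dB, dA', dB', ← hμ, ← hν]
    exact step_arith s (p' e).2.1 (hpp e) (p e).2.2 hv ht hv' ht' ha hb ha' hb' g₀₀ g₁₁ g₁₀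

end MonotonePolarizedStrongHarris

open MonotonePolarizedStrongHarris

/-- **Monotone polarized strong Harris–Kleitman inequality (cylinder-event form, two systems).**  For
product measures `μ = prodBernoulli p`, `ν = prodBernoulli p'` with `p' ≤ p` coordinatewise and two
Gladkov systems `(A, C, B)`, `(A', C', B')` of events determined by a finite `F` satisfying the
cross-condition (for `i ≠ j` no `ω' ≤ ω` with `ω ∈ C i`, `ω' ∈ C' j`) (`B`, `B'` the complements of `A ∪ ⋃ C i`, `A' ∪ ⋃ C' i`):
`(Σ μ(C i))(Σ ν(C' j)) − Σ μ(C i) ν(C' i) ≤ μ(A) ν(B') + ν(A') μ(B)`. [this work] -/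
theorem prodBernoulli_polarized_strongHarris_of_determinedBy (p p' : ι → unitInterval)
    (hpp : ∀ e, (p' e : ℝ) ≤ p e) {κ : Type*} (s : Finset κ) (F : Finset ι)
    {A A' : Set (Set ι)} {C C' : κ → Set (Set ι)}
    (hdisj : ∀ i ∈ s, ∀ j ∈ s, i ≠ j → Disjoint (C i) (C j)) (hdisjA : ∀ i ∈ s, Disjoint A (C i))
    (hup : ∀ i ∈ s, IsUpperSet (A ∪ C i)) (hA : IsUpperSet A)
    (hAF : DeterminedBy A (↑F : Set ι)) (hCF : ∀ i ∈ s, DeterminedBy (C i) (↑F : Set ι))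
    (hdisj' : ∀ i ∈ s, ∀ j ∈ s, i ≠ j → Disjoint (C' i) (C' j)) (hdisjA' : ∀ i ∈ s, Disjoint A' (C' i))
    (hup' : ∀ i ∈ s, IsUpperSet (A' ∪ C' i)) (hA' : IsUpperSet A')
    (hAF' : DeterminedBy A' (↑F : Set ι)) (hCF' : ∀ i ∈ s, DeterminedBy (C' i) (↑F : Set ι))
    (hX : (∀ i ∈ s, ∀ j ∈ s, i ≠ j → ∀ ω ω' : Set ι, ω' ≤ ω → ω ∈ C i → ω' ∉ C' j)) :
    (∑ i ∈ s, (prodBernoulli p).real (C i)) * (∑ i ∈ s, (prodBernoulli p').real (C' i)) -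
        ∑ i ∈ s, (prodBernoulli p).real (C i) * (prodBernoulli p').real (C' i) ≤
      (prodBernoulli p).real A * (prodBernoulli p').real (A' ∪ ⋃ i ∈ s, C' i)ᶜ +
        (prodBernoulli p').real A' * (prodBernoulli p).real (A ∪ ⋃ i ∈ s, C i)ᶜ := by
  classical
  refine core p p' hpp s F A _ C A' _ C' hdisj hdisjA hup hA (fun ω => ?_) hAF hCF hdisj' hdisjA'
    hup' hA' (fun ω => ?_) hAF' hCF' hX
  · simp only [Set.mem_compl_iff, Set.mem_union, Set.mem_iUnion, exists_prop, not_or, not_exists,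
      not_and]
  · simp only [Set.mem_compl_iff, Set.mem_union, Set.mem_iUnion, exists_prop, not_or, not_exists,
      not_and]

/-- **Monotone polarized strong Harris–Kleitman inequality, one system, finite index type.**  For
`ι` finite, `p' ≤ p`, cells `C i` pairwise disjoint and disjoint from the up-set `A` with every
`A ∪ C i` closed upwards, and `B := (A ∪ ⋃ C i)ᶜ`:
`(Σ μ(C i))(Σ ν(C j)) − Σ μ(C i) ν(C i) ≤ μ(A) ν(B) + ν(A) μ(B)` (`μ = prodBernoulli p`,
`ν = prodBernoulli p'`), i.e. `Σ_{i ≠ j} μ(C i) ν(C j) ≤ μ(A) ν(B) + ν(A) μ(B)`; for `p = p'` this is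
Gladkov's `2 e₂(μ(C)) ≤ 2 μ(A) μ(B)`. [this work] -/
theorem prodBernoulli_polarized_strongHarris [Finite ι] (p p' : ι → unitInterval)
    (hpp : ∀ e, (p' e : ℝ) ≤ p e) {κ : Type*} (s : Finset κ) {A : Set (Set ι)} {C : κ → Set (Set ι)}
    (hdisj : ∀ i ∈ s, ∀ j ∈ s, i ≠ j → Disjoint (C i) (C j))
    (hdisjA : ∀ i ∈ s, Disjoint A (C i)) (hup : ∀ i ∈ s, IsUpperSet (A ∪ C i)) (hA : IsUpperSet A) :
    (∑ i ∈ s, (prodBernoulli p).real (C i)) * (∑ i ∈ s, (prodBernoulli p').real (C i)) -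
        ∑ i ∈ s, (prodBernoulli p).real (C i) * (prodBernoulli p').real (C i) ≤
      (prodBernoulli p).real A * (prodBernoulli p').real (A ∪ ⋃ i ∈ s, C i)ᶜ +
        (prodBernoulli p').real A * (prodBernoulli p).real (A ∪ ⋃ i ∈ s, C i)ᶜ := by
  classical
  haveI := Fintype.ofFinite ι
  have hall : ∀ X : Set (Set ι), DeterminedBy X (↑(Finset.univ : Finset ι) : Set ι) := fun X => by
    rw [determinedBy_iff]; intro ω ω' h; simp only [Finset.coe_univ, Set.inter_univ] at h; rw [h]
  exact prodBernoulli_polarized_strongHarris_of_determinedBy p p' hpp s Finset.univ hdisj hdisjA hup hA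
    (hall A) (fun i _ => hall (C i)) hdisj hdisjA hup hA (hall A) (fun i _ => hall (C i))
    (cross_self hdisj hdisjA hup)

/-- **Three-petal sunflower form, polarized** (the shape used in percolation): for increasing events
`E₁ E₂ E₃` with a common pairwise intersection `A`, petals `P_i = E_i ∖ A` and bottom
`Q = (E₁ ∪ E₂ ∪ E₃)ᶜ`, and `p' ≤ p` (`μ = prodBernoulli p`, `ν = prodBernoulli p'`):
`Σ_{i ≠ j} μ(P_i) ν(P_j) ≤ μ(A) ν(Q) + ν(A) μ(Q)`.  With `E_c = {a↔b}`, `E_b = {a↔c}`, `E_a = {b↔c}`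
(core `{a↔b↔c}`) this is the POLARIZED AAS–GLADKOV three-point inequality `q t' + q' t ≥ Σ_{x≠z} u_x u'_z`
for edge weights `w' ≤ w`. [this work] -/
theorem prodBernoulli_polarized_strongHarris_sunflower_three [Finite ι] (p p' : ι → unitInterval)
    (hpp : ∀ e, (p' e : ℝ) ≤ p e) {A E₁ E₂ E₃ : Set (Set ι)} (h₁ : IsUpperSet E₁) (h₂ : IsUpperSet E₂)
    (h₃ : IsUpperSet E₃) (h12 : E₁ ∩ E₂ = A) (h13 : E₁ ∩ E₃ = A) (h23 : E₂ ∩ E₃ = A) :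
    (prodBernoulli p).real (E₁ \ A) * (prodBernoulli p').real (E₂ \ A) +
        (prodBernoulli p').real (E₁ \ A) * (prodBernoulli p).real (E₂ \ A) +
        (prodBernoulli p).real (E₁ \ A) * (prodBernoulli p').real (E₃ \ A) +
        (prodBernoulli p').real (E₁ \ A) * (prodBernoulli p).real (E₃ \ A) +
        (prodBernoulli p).real (E₂ \ A) * (prodBernoulli p').real (E₃ \ A) +
        (prodBernoulli p').real (E₂ \ A) * (prodBernoulli p).real (E₃ \ A) ≤
      (prodBernoulli p).real A * (prodBernoulli p').real (E₁ ∪ E₂ ∪ E₃)ᶜ +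
        (prodBernoulli p').real A * (prodBernoulli p).real (E₁ ∪ E₂ ∪ E₃)ᶜ := by
  classical
  have hA : IsUpperSet A := by rw [← h12]; exact h₁.inter h₂
  let E : Fin 3 → Set (Set ι) := ![E₁, E₂, E₃]
  have e0 : E 0 = E₁ := rfl
  have e1 : E 1 = E₂ := rfl
  have e2 : E 2 = E₃ := rfl
  set s : Finset (Fin 3) := Finset.univ with hs
  have hE : ∀ i ∈ s, IsUpperSet (E i) := by
    intro i _; fin_cases i
    · exact h₁
    · exact h₂
    · exact h₃
  have hAE : ∀ i ∈ s, A ⊆ E i := by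
    intro i _; fin_cases i
    · change A ⊆ E₁; rw [← h12]; exact Set.inter_subset_left
    · change A ⊆ E₂; rw [← h12]; exact Set.inter_subset_right
    · change A ⊆ E₃; rw [← h13]; exact Set.inter_subset_right
  have hcore : ∀ i ∈ s, ∀ j ∈ s, i ≠ j → E i ∩ E j ⊆ A := by
    intro i _ j _ hij
    fin_cases i <;> fin_cases j
    all_goals first
      | exact (hij rfl).elim
      | (change E₁ ∩ E₂ ⊆ A; exact h12.le)
      | (change E₂ ∩ E₁ ⊆ A; rw [Set.inter_comm]; exact h12.le)
      | (change E₁ ∩ E₃ ⊆ A; exact h13.le)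
      | (change E₃ ∩ E₁ ⊆ A; rw [Set.inter_comm]; exact h13.le)
      | (change E₂ ∩ E₃ ⊆ A; exact h23.le)
      | (change E₃ ∩ E₂ ⊆ A; rw [Set.inter_comm]; exact h23.le)
  -- petals as middle cells
  have hdisj : ∀ i ∈ s, ∀ j ∈ s, i ≠ j → Disjoint (E i \ A) (E j \ A) := by
    intro i hi j hj hij
    exact Set.disjoint_left.2 fun ω hω1 hω2 => hω1.2 (hcore i hi j hj hij ⟨hω1.1, hω2.1⟩)
  have hdisjA : ∀ i ∈ s, Disjoint A (E i \ A) :=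
    fun i _ => Set.disjoint_left.2 fun ω hω h => h.2 hω
  have hAC : ∀ i ∈ s, A ∪ (E i \ A) = E i := fun i hi => by
    rw [Set.union_sdiff_cancel (hAE i hi)]
  have hup : ∀ i ∈ s, IsUpperSet (A ∪ (E i \ A)) := fun i hi => by
    rw [hAC i hi]; exact hE i hi
  have key := prodBernoulli_polarized_strongHarris p p' hpp s hdisj hdisjA hup hA
  have hU : (A ∪ ⋃ i ∈ s, (E i \ A)) = E₁ ∪ E₂ ∪ E₃ := by
    ext ω
    simp only [hs, Finset.mem_univ, Set.iUnion_true, Set.mem_union, Set.mem_iUnion, Set.mem_sdiff]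
    constructor
    · rintro (h | ⟨i, hi, -⟩)
      · exact Or.inl (Or.inl ((h12.symm.le h : ω ∈ E₁ ∩ E₂).1))
      · fin_cases i
        · exact Or.inl (Or.inl hi)
        · exact Or.inl (Or.inr hi)
        · exact Or.inr hi
    · rintro ((h | h) | h)
      · by_cases hω : ω ∈ A
        · exact Or.inl hω
        · exact Or.inr ⟨0, h, hω⟩
      · by_cases hω : ω ∈ A
        · exact Or.inl hω
        · exact Or.inr ⟨1, h, hω⟩
      · by_cases hω : ω ∈ A
        · exact Or.inl hω
        · exact Or.inr ⟨2, h, hω⟩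
  rw [hU] at key
  simp only [hs, Fin.sum_univ_three, e0, e1, e2] at key
  nlinarith [key]

end Summit.CriticalPhenomena.PercolationContinuityZ3.Theorems

end
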